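import Summits.KontsevichZagierPeriods.Zeta5Search.Denom.TwoTaleP15WindowGap
import Summits.KontsevichZagierPeriods.Zeta5Search.Denom.TwoTaleP15TopWindow

/-!
# `TopWindowT` holds: the window `13n < p ≤ 17n` (THEOREM W) + the slice `p > 17n` (P1)

HONEST FRAMING: systematic search; no irrationality claim unless certified.  Cell `pub-zeta5`,
DENOMINATOR ARITHMETIC lane, THEOREM W of `families/denom/P15KERNEL.md` §10.9, steps (U) and the
assembly.  Pure `p`-adic bookkeeping of `p̂_n = formPT (aT n) (bT n)`; the ONLY consumer is the
CONDITIONAL chain `Denom.TwoTaleP15TopWindow.zetaTwo_exponent_le_of_topWindowT` (still conditional on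
`DecayT 28.462` and `Prop3T`); nothing here is a statement about irrationality.

* (U) `padicNorm_Utop_le`: for `13n < p ≤ 17n` every top value `R̂(t_k)`, `k ∈ T`, is either `0`
  (`2k − p ≤ 32n+1`, the doubled zero block) or has `‖R̂(t_k)‖_p ≤ p^{[p ≤ 16n]}`: the prefactor
  `Π̂` has norm `p` (`17n/p = 1`), the doubled block contains the factor `2t_k + (2k − 2p) = −p`, the
  block `(t + 6n+1)⋯(t + 11n)` contains `t_k + (k − p) = −p/2` whenever `k − p ≤ 11n`, and the pole
  blocks have norm exactly `p^{−1−[k ≤ 24n+1]}`;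
* `padicNorm_formPT_window`: **`‖p̂_n‖_p ≤ p^{[p ≤ 16n]}` for every `n ≥ 1` and every prime
  `13n < p ≤ 17n`** (from `‖sgn·p̂_n − U/2‖_p ≤ 1` of part II);
* `topWindowT_holds : TopWindowT` — with P1's slice lemma
  `TwoTaleP15Slice.padicNorm_formPT_le_one_of_gt` (`p > 17n`); in fact for every `n ≥ 1`
  (`topWindow_all`), not only eventually.
-/

noncomputable section

namespace Summit.KontsevichZagierPeriods.Zeta5Search.Denom.TwoTaleP15Window

open Finset Polynomial
open Literature.NumberTheory.Irrationality.Zudilin2014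
open Summit.KontsevichZagierPeriods.Zeta5Search.TwoTaleP15
open Summit.KontsevichZagierPeriods.Zeta5Search.Denom.WindowModP
open Summit.KontsevichZagierPeriods.Zeta5Search.Denom.TwoTaleP15TopWindow (TopWindowT)

variable {n : ℕ} {p : ℕ} [hp : Fact p.Prime] {h : ℕ}

/-- `‖2‖_p = 1` for odd `p` (file-local copy; the public statement is the tree's
`SecondOrder.padicNorm_two` — kept private here to avoid a `dedup.landed` twin; lane edit lead/lit g13). -/
private theorem padicNorm_two_eq_one (h2 : p ≠ 2) : padicNorm p (2 : ℚ) = 1 := by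
  simpa using padicNorm.padicNorm_of_prime_of_ne (p := p) (q := 2) h2

/-! ### (U) The top values `R̂(t_k)` in the window -/

/-- `‖Π̂‖_p = p` for `13n < p ≤ 17n` (exactly one multiple of `p` in `17n!`, none in `11n!`, `5n!`). -/
theorem padicNorm_normT_window (hp13 : 13 * n < p) (hp17 : p ≤ 17 * n) :
    padicNorm p (normT (aT n) (bT n)) = p := by
  have hp2 : 26 * n < p ^ 2 := by nlinarith [hp.out.two_le]
  rw [padicNorm_normT_partner hp2, Nat.div_eq_of_lt (by omega : 11 * n < p),
    Nat.div_eq_of_lt (by omega : 5 * n < p), Nat.div_eq_of_lt_le (by omega) (by omega : 17 * n < (1 + 1) * p)]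
  simp

/-- The doubled numerator block at `t_k` contains the factor `−p` (`ℓ = 2k − 2p`) when
`32n+2 ≤ 2k − p`, `k ≤ 26n+1`, `10n < p ≤ 17n`: its norm is `≤ p⁻¹`. -/
theorem padicNorm_block2_tk_le (hp13 : 13 * n < p) (hp17 : p ≤ 17 * n) {k : ℤ}
    (hB : 32 * (n : ℤ) + 2 ≤ 2 * k - p) (hk : k ≤ 26 * (n : ℤ) + 1) :
    padicNorm p (∏ l ∈ Ico (bT n 0) (aT n 0), (2 * ((p : ℚ) / 2 - k) + l)) ≤ (p : ℚ)⁻¹ := by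
  have hp17' : (p : ℤ) ≤ 17 * n := by exact_mod_cast hp17
  have hp13' : 13 * (n : ℤ) < p := by exact_mod_cast hp13
  have hmem : 2 * k - 2 * p ∈ Ico (bT n 0) (aT n 0) := by simp [mem_Ico]; omega
  rw [← mul_prod_erase _ _ hmem, padicNorm.mul]
  have e : 2 * ((p : ℚ) / 2 - k) + ((2 * k - 2 * p : ℤ) : ℚ) = -(p : ℚ) := by push_cast; ring
  rw [e, padicNorm.neg, padicNorm.padicNorm_p_of_prime]
  calc (p : ℚ)⁻¹ * padicNorm p (∏ x ∈ (Ico (bT n 0) (aT n 0)).erase (2 * k - 2 * p), (2 * ((p : ℚ) / 2 - k) + x))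
      ≤ (p : ℚ)⁻¹ * 1 := mul_le_mul_of_nonneg_left
        (padicNorm_prod_le_one fun l _ => padicNorm_two_tk_add_le_one k l) (by positivity)
    _ = (p : ℚ)⁻¹ := mul_one _

/-- `‖numT(t_k)‖_p ≤ 1` in the window (`Π̂` contributes `p`, the doubled block `p⁻¹`). -/
theorem padicNorm_eval_numT_tk_le_one (hp13 : 13 * n < p) (hp17 : p ≤ 17 * n) {k : ℤ}
    (hB : 32 * (n : ℤ) + 2 ≤ 2 * k - p) (hk : k ≤ 26 * (n : ℤ) + 1) :
    padicNorm p ((numT (aT n) (bT n)).eval ((p : ℚ) / 2 - k)) ≤ 1 := by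
  have h2 : p ≠ 2 := by omega
  have hp0 : (p : ℚ) ≠ 0 := by exact_mod_cast hp.out.ne_zero
  unfold numT
  rw [eval_mul, eval_C, eval_mul, eval_block2, eval_block, padicNorm.mul, padicNorm_normT_window hp13 hp17,
    padicNorm.mul]
  have hD := padicNorm_block2_tk_le hp13 hp17 hB hk
  have hB1 : padicNorm p (∏ j ∈ Ico (bT n 1) (aT n 1), ((p : ℚ) / 2 - k + j)) ≤ 1 :=
    padicNorm_prod_le_one fun j _ => padicNorm_tk_add_le_one h2 k j
  calc (p : ℚ) * (padicNorm p (∏ l ∈ Ico (bT n 0) (aT n 0), (2 * ((p : ℚ) / 2 - k) + l))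
        * padicNorm p (∏ j ∈ Ico (bT n 1) (aT n 1), ((p : ℚ) / 2 - k + j)))
      ≤ p * ((p : ℚ)⁻¹ * 1) := mul_le_mul_of_nonneg_left
          (mul_le_mul hD hB1 (padicNorm.nonneg _) (by positivity)) (by positivity)
    _ = 1 := by rw [mul_one, mul_inv_cancel₀ hp0]

/-- `‖numT(t_k)‖_p ≤ p⁻¹` in the window when moreover `k − p ≤ 11n` (the block `(t+6n+1)⋯(t+11n)`
contains `t_k + (k − p) = −p/2`). -/
theorem padicNorm_eval_numT_tk_le_inv (hp13 : 13 * n < p) (hp17 : p ≤ 17 * n) {k : ℤ}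
    (hB : 32 * (n : ℤ) + 2 ≤ 2 * k - p) (hk : k ≤ 26 * (n : ℤ) + 1) (h11 : k - p ≤ 11 * (n : ℤ)) :
    padicNorm p ((numT (aT n) (bT n)).eval ((p : ℚ) / 2 - k)) ≤ (p : ℚ)⁻¹ := by
  have h2 : p ≠ 2 := by omega
  have hp0 : (p : ℚ) ≠ 0 := by exact_mod_cast hp.out.ne_zero
  have hp17' : (p : ℤ) ≤ 17 * n := by exact_mod_cast hp17
  unfold numT
  rw [eval_mul, eval_C, eval_mul, eval_block2, eval_block, padicNorm.mul, padicNorm_normT_window hp13 hp17,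
    padicNorm.mul]
  have hD := padicNorm_block2_tk_le hp13 hp17 hB hk
  have hmem : k - p ∈ Ico (bT n 1) (aT n 1) := by simp [mem_Ico]; omega
  have hB1 : padicNorm p (∏ j ∈ Ico (bT n 1) (aT n 1), ((p : ℚ) / 2 - k + j)) ≤ (p : ℚ)⁻¹ := by
    rw [← mul_prod_erase _ _ hmem, padicNorm.mul]
    have e : (p : ℚ) / 2 - k + ((k - p : ℤ) : ℚ) = -((p : ℚ) / 2) := by push_cast; ring
    rw [e, padicNorm.neg, padicNorm_half_p h2]
    calc (p : ℚ)⁻¹ * padicNorm p (∏ x ∈ (Ico (bT n 1) (aT n 1)).erase (k - p), ((p : ℚ) / 2 - k + x))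
        ≤ (p : ℚ)⁻¹ * 1 := mul_le_mul_of_nonneg_left
          (padicNorm_prod_le_one fun j _ => padicNorm_tk_add_le_one h2 k j) (by positivity)
      _ = (p : ℚ)⁻¹ := mul_one _
  calc (p : ℚ) * (padicNorm p (∏ l ∈ Ico (bT n 0) (aT n 0), (2 * ((p : ℚ) / 2 - k) + l))
        * padicNorm p (∏ j ∈ Ico (bT n 1) (aT n 1), ((p : ℚ) / 2 - k + j)))
      ≤ p * ((p : ℚ)⁻¹ * (p : ℚ)⁻¹) := mul_le_mul_of_nonneg_left
          (mul_le_mul hD hB1 (padicNorm.nonneg _) (by positivity)) (by positivity)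
    _ = (p : ℚ)⁻¹ := by rw [← mul_assoc, mul_inv_cancel₀ hp0, one_mul]

/-- `‖denT(t_k)‖_p = p^{−1−[k ≤ 24n+1]}`: written as the two cases. -/
theorem padicNorm_eval_denT_tk (hp13 : 13 * n < p) (hp17 : p ≤ 17 * n) {k : ℤ}
    (hk1 : 15 * (n : ℤ) + 1 ≤ k) (hk : k ≤ 26 * (n : ℤ) + 1) :
    padicNorm p ((denT (aT n) (bT n)).eval ((p : ℚ) / 2 - k))
      = (if k ≤ 24 * (n : ℤ) + 1 then (p : ℚ)⁻¹ else 1) * (p : ℚ)⁻¹ := by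
  have h2 : p ≠ 2 := by omega
  have hp13' : 13 * (n : ℤ) < p := by exact_mod_cast hp13
  unfold denT
  rw [eval_mul, eval_block, eval_block, padicNorm.mul,
    padicNorm_prod_tk_eq_inv h2 (k := k) (lo := aT n 3) (hi := bT n 3) (by simp [mem_Ico]; omega)
      (fun j hj => by simp only [mem_Ico, aT_three, bT_three] at hj; omega)]
  by_cases h24 : k ≤ 24 * (n : ℤ) + 1
  · rw [if_pos h24, padicNorm_prod_tk_eq_inv h2 (k := k) (by simp [mem_Ico]; omega)
      (fun j hj => by simp only [mem_Ico, aT_two, bT_two] at hj; omega)]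
  · rw [if_neg h24, padicNorm_prod_tk_eq_one h2 (k := k) (by simp [mem_Ico]; omega)
      (fun j hj => by simp only [mem_Ico, aT_two, bT_two] at hj; omega)]

/-- Window bound for a nonzero top value: `‖R̂(t_k)‖_p ≤ p` (`13n < p ≤ 17n`, `2k − p ≥ 32n+2`). -/
theorem padicNorm_RT_tk_le_p (hp13 : 13 * n < p) (hp17 : p ≤ 17 * n) {k : ℤ}
    (hB : 32 * (n : ℤ) + 2 ≤ 2 * k - p) (hk : k ≤ 26 * (n : ℤ) + 1) :
    padicNorm p (RT (aT n) (bT n) ((p : ℚ) / 2 - k)) ≤ p := by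
  have hp0 : (0 : ℚ) < p := by exact_mod_cast hp.out.pos
  have hp13' : 13 * (n : ℤ) < p := by exact_mod_cast hp13
  unfold RT
  rw [padicNorm.div, padicNorm_eval_denT_tk hp13 hp17 (by omega) hk]
  by_cases h24 : k ≤ 24 * (n : ℤ) + 1
  · rw [if_pos h24, div_le_iff₀ (by positivity)]
    refine (padicNorm_eval_numT_tk_le_inv hp13 hp17 hB hk (by omega)).trans (le_of_eq ?_)
    field_simp
  · rw [if_neg h24, one_mul, div_le_iff₀ (by positivity)]
    refine (padicNorm_eval_numT_tk_le_one hp13 hp17 hB hk).trans (le_of_eq ?_)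
    field_simp

/-- Window bound for a nonzero top value when `16n < p ≤ 17n`: `‖R̂(t_k)‖_p ≤ 1`. -/
theorem padicNorm_RT_tk_le_one_window (hp16 : 16 * n < p) (hp17 : p ≤ 17 * n) {k : ℤ}
    (hB : 32 * (n : ℤ) + 2 ≤ 2 * k - p) (hk : k ≤ 26 * (n : ℤ) + 1) :
    padicNorm p (RT (aT n) (bT n) ((p : ℚ) / 2 - k)) ≤ 1 := by
  have hp0 : (0 : ℚ) < p := by exact_mod_cast hp.out.pos
  have hp16' : 16 * (n : ℤ) < p := by exact_mod_cast hp16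
  have hp17' : (p : ℤ) ≤ 17 * n := by exact_mod_cast hp17
  unfold RT
  rw [padicNorm.div, padicNorm_eval_denT_tk (by omega) hp17 (by omega) hk, if_neg (by omega), one_mul,
    div_le_iff₀ (by positivity), one_mul]
  exact padicNorm_eval_numT_tk_le_inv (by omega) hp17 hB hk (by omega)

/-- **(U)** `‖U‖_p ≤ p^{[p ≤ 16n]}` for `p = 2h+1`, `13n < p ≤ 17n`. -/
theorem padicNorm_Utop_le (hph : p = 2 * h + 1) (hp13 : 13 * n < p) (hp17 : p ≤ 17 * n) :
    padicNorm p (Utop n p h) ≤ (p : ℚ) ^ (if p ≤ 16 * n then (1 : ℤ) else 0) := by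
  have hp13' : 13 * (n : ℤ) < p := by exact_mod_cast hp13
  unfold Utop
  refine padicNorm.sum_le' (fun k hk => ?_) (by positivity)
  rw [mem_topSet] at hk
  rcases le_or_gt (2 * k - (p : ℤ)) (32 * (n : ℤ) + 1) with hA | hB
  · rw [RT_tk_eq_zero (by omega) hA, padicNorm.zero]; positivity
  by_cases h16 : p ≤ 16 * n
  · rw [if_pos h16, zpow_one]; exact padicNorm_RT_tk_le_p hp13 hp17 (by omega) (by omega)
  · rw [if_neg h16, zpow_zero]; exact padicNorm_RT_tk_le_one_window (by omega) hp17 (by omega) (by omega)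

/-! ### Assembly -/

/-- **THEOREM W (the window of `TopWindowT`)**: for every `n ≥ 1` and every prime `13n < p ≤ 17n`,
`‖p̂_n‖_p ≤ p^{[p ≤ 16n]}` — primes in `(16n, 17n]` do not divide `den p̂_n`, primes in `(13n, 16n]`
divide it at most once. -/
theorem padicNorm_formPT_window (hn : 1 ≤ n) (hp13 : 13 * n < p) (hp17 : p ≤ 17 * n) :
    padicNorm p (formPT (aT n) (bT n)) ≤ (p : ℚ) ^ (if p ≤ 16 * n then (1 : ℤ) else 0) := by
  have h2 : p ≠ 2 := by omega
  obtain ⟨h, hph⟩ : ∃ h, p = 2 * h + 1 := hp.out.odd_of_ne_two h2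
  have hsign : padicNorm p (signT (bT n)) = 1 := by
    unfold signT; rcases neg_one_pow_eq_or ℚ (bT n 2 + bT n 3).natAbs with e | e <;> rw [e] <;> simp
  have hS := padicNorm_signT_formPT_sub_half_U_le_one hn hph hp13 hp17
  have hU : padicNorm p (Utop n p h / 2) ≤ (p : ℚ) ^ (if p ≤ 16 * n then (1 : ℤ) else 0) := by
    rw [padicNorm.div, padicNorm_two_eq_one h2, div_one]; exact padicNorm_Utop_le hph hp13 hp17
  have h1 : (1 : ℚ) ≤ (p : ℚ) ^ (if p ≤ 16 * n then (1 : ℤ) else 0) :=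
    one_le_zpow₀ (by exact_mod_cast hp.out.one_lt.le) (by split_ifs <;> norm_num)
  have e : formPT (aT n) (bT n)
      = signT (bT n) * ((signT (bT n) * formPT (aT n) (bT n) - Utop n p h / 2) + Utop n p h / 2) := by
    rw [sub_add_cancel, ← mul_assoc, signT_mul_self, one_mul]
  rw [e, padicNorm.mul, hsign, one_mul]
  exact padicNorm.nonarchimedean.trans (max_le (hS.trans h1) hU)

/-- The whole top window, for EVERY `n ≥ 1`: for every prime `15n < p ≤ 26n+1`,
`‖p̂_n‖_p ≤ p^{[p ≤ 16n]}` (window `p ≤ 17n`: THEOREM W; `p > 17n`: P1's slice lemma). -/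
theorem topWindow_all (hn : 1 ≤ n) (hp15 : 15 * n < p) (hp26 : p ≤ 26 * n + 1) :
    padicNorm p (formPT (aT n) (bT n)) ≤ (p : ℚ) ^ (if p ≤ 16 * n then (1 : ℤ) else 0) := by
  have _ := hp26
  by_cases hp17 : p ≤ 17 * n
  · exact padicNorm_formPT_window hn (by omega) hp17
  · rw [if_neg (by omega), zpow_zero]
    exact padicNorm_formPT_le_one_of_gt hn (by omega)

/-- **`TopWindowT` holds** (fam-denom D16 input of the conditional `(bmiss)`-free closing
`TwoTaleP15TopWindow.zetaTwo_exponent_le_of_topWindowT`, which remains conditional on `DecayT 28.462`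
and `Prop3T`). -/
theorem topWindowT_holds : TopWindowT := by
  unfold TopWindowT
  refine Filter.eventually_atTop.2 ⟨1, fun n hn p hprime hp15 hp26 => ?_⟩
  haveI : Fact p.Prime := ⟨hprime⟩
  exact topWindow_all hn hp15 hp26

end Summit.KontsevichZagierPeriods.Zeta5Search.Denom.TwoTaleP15Window

end
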